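import Mathlib
import Summits.Schanuel.Schanuel.Theorems.AclSubsetLogFreeCore.Negative.ExpAclField
import Summits.Schanuel.Schanuel.Theorems.AclSubsetLogFreeCore.Negative.BranchParity
import Literature.ModelTheory.ExponentialFields.DefinabilityParams

/-!
# Crux `AclSubsetLogFreeCore` — calibration against Koiran's question: (A) + "`ℝ` is `∅`-definable in `ℂ_exp`" forces `C_EA ∩ ℝ_{>0}` to be closed under the real logarithm

Theorems for the crux (A) `RigidCore.AclSubsetLogFreeCore` (stmt-Schanuel-0968).  The route's own
kill criterion is "`ℝ` (or a branch of `log 2`) shown `∅`-definable in `ℂ_exp`".  This file makes the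
dependence formal and unconditional in the direction available to Lean:

* `log_mem_logFreeCore_of_real_definable`: if (A) holds and `ℝ ⊆ ℂ` is `∅`-definable, then for every
  positive real `a ∈ C_EA` also `ln a ∈ C_EA` (the set `{z ∈ ℝ | e^z ∈ t}` for a finite `∅`-definable
  `t ∋ a` — which exists by the tightness `C_EA ⊆ acl(∅)` — is finite and `∅`-definable, and `exp` is
  injective on `ℝ`);
* hence `ln 2, ln 3, ln π, ln ln π, … ∈ C_EA = K_ω` (`log_two_mem_logFreeCore_of_real_definable`,
  `log_pi_mem_logFreeCore_of_real_definable`, `log_log_pi_mem_logFreeCore_of_real_definable`), each of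
  which contradicts Schanuel's conjecture (`K_ω` is the FREE EA-closure of `ℚ(2πi)`).

So **(A) ∧ SC ⇒ `ℝ` is not `∅`-definable in `ℂ_exp`** (the parameter-free case of Koiran's 2003
conjecture / Zilber–Wilkie 1993 question, open): a proof of (A) is, modulo SC, a proof of a 30-year-old
undefinability statement.  (On paper the SC can be removed — `Def_∅(ℝ)` alone refutes (A) via a
non-computable `∅`-definable real versus `C_EA ⊆` computable numbers; see the crux workfile
`Cruxes/AclSubsetLogFreeCore/Disproof.lean` §12.)

## References

* [Koiran2003] P. Koiran, *The theory of Liouville functions*, JSL 68 (2003) 353–365 (conjecture: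
  `ℝ` is not definable in `ℂ_exp`).
* [Wilkie2024] A. J. Wilkie, *Analytic continuation and Zilber's quasiminimality conjecture*, Model
  Theory 3 (2024) 701–, arXiv:2306.14562, p. 1 ("If the set of reals was also definable then the
  situation would indeed be hopeless").
* [KirbyMacintyreOnshuus2012] arXiv:1101.4224, p. 2 (setwise definability of `ℝ` in `ℂ_exp`: open).
-/

noncomputable section

set_option linter.dupNamespace false

open FirstOrder FirstOrder.Language Set
open Literature.ModelTheory.ExponentialFields

namespace Summit.Schanuel.Schanuel.Theorems.AclSubsetLogFreeCore.Negative

/-- The real points of the `exp`-preimage of a finite set form a finite set (`exp` is injective on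
`ℝ`). -/
theorem finite_real_exp_preimage {t : Set ℂ} (ht : t.Finite) :
    {z : ℂ | Complex.exp z ∈ t ∧ z ∈ Set.range ((↑) : ℝ → ℂ)}.Finite := by
  refine Set.Finite.of_finite_image (f := Complex.exp) (ht.subset ?_) ?_
  · rintro _ ⟨z, hz, rfl⟩; exact hz.1
  · rintro z ⟨-, ⟨r, rfl⟩⟩ w ⟨-, ⟨s, rfl⟩⟩ h
    have h' : Real.exp r = Real.exp s := by
      apply Complex.ofReal_injective
      simpa [Complex.ofReal_exp] using h
    rw [Real.exp_eq_exp.1 h']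

/-- If `ℝ` is `∅`-definable, so is the set of real points of the `exp`-preimage of an `∅`-definable
set. -/
theorem definable₁_real_exp_preimage
    (hR : Set.Definable₁ (∅ : Set ℂ) Language.expRing (Set.range ((↑) : ℝ → ℂ)))
    {t : Set ℂ} (ht : Set.Definable₁ (∅ : Set ℂ) Language.expRing t) :
    Set.Definable₁ (∅ : Set ℂ) Language.expRing
      {z : ℂ | Complex.exp z ∈ t ∧ z ∈ Set.range ((↑) : ℝ → ℂ)} :=
  definable_setOf_and_params
    (definable_mem_of_definable₁ ht (definableFun_cexp (definableFun_proj_params _)))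
    (definable_mem_of_definable₁ hR (definableFun_proj_params _))

/-- **(A) + `Def_∅(ℝ)` ⇒ `C_EA ∩ ℝ_{>0}` is closed under the real logarithm.**  Uses the tightness
`C_EA ⊆ acl(∅)` (`logFreeCore_subset_expAcl`). -/
theorem log_mem_logFreeCore_of_real_definable
    (hA : Summit.Schanuel.Schanuel.Theses.RigidCore.AclSubsetLogFreeCore)
    (hR : Set.Definable₁ (∅ : Set ℂ) Language.expRing (Set.range ((↑) : ℝ → ℂ)))
    {a : ℝ} (ha0 : 0 < a) (ha : (a : ℂ) ∈ logFreeCore) :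
    (Real.log a : ℂ) ∈ logFreeCore := by
  obtain ⟨t, htfin, htdef, hat⟩ := logFreeCore_subset_expAcl ha
  rw [aclSubsetLogFreeCore_iff] at hA
  refine hA ⟨_, finite_real_exp_preimage htfin, definable₁_real_exp_preimage hR htdef, ?_, ⟨_, rfl⟩⟩
  show Complex.exp (Real.log a : ℂ) ∈ t
  rwa [← Complex.ofReal_exp, Real.exp_log ha0]

/-- In particular **(A) + `Def_∅(ℝ)` ⇒ `ln 2 ∈ C_EA`** (contradicting SC), -/
theorem log_two_mem_logFreeCore_of_real_definable
    (hA : Summit.Schanuel.Schanuel.Theses.RigidCore.AclSubsetLogFreeCore)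
    (hR : Set.Definable₁ (∅ : Set ℂ) Language.expRing (Set.range ((↑) : ℝ → ℂ))) :
    (Real.log 2 : ℂ) ∈ logFreeCore := by
  have h := log_mem_logFreeCore_of_real_definable hA hR (a := 2) two_pos (by simp)
  simpa using h

/-- **… ⇒ `ln π ∈ C_EA`** (contradicting SC), -/
theorem log_pi_mem_logFreeCore_of_real_definable
    (hA : Summit.Schanuel.Schanuel.Theses.RigidCore.AclSubsetLogFreeCore)
    (hR : Set.Definable₁ (∅ : Set ℂ) Language.expRing (Set.range ((↑) : ℝ → ℂ))) :
    (Real.log Real.pi : ℂ) ∈ logFreeCore := by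
  refine log_mem_logFreeCore_of_real_definable hA hR Real.pi_pos ?_
  -- `π ∈ C_EA` (`π = 2πi / 2i`, `i` algebraic)
  have hI : Complex.I ∈ logFreeCore := by
    refine logFreeCore_mem_coreFamily.2.2 _ ⟨Polynomial.X ^ 2 + 1, ?_, by simp⟩
    exact (Polynomial.monic_X_pow_add_C (1 : logFreeCore) two_ne_zero).ne_zero
  have h2' : (2 : ℂ) ∈ logFreeCore := by simp
  have : (Real.pi : ℂ) = (2 * ↑Real.pi * Complex.I) / (2 * Complex.I) := by field_simp
  rw [this]
  exact div_mem two_pi_I_mem_logFreeCore (mul_mem h2' hI)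

/-- **… ⇒ `ln ln π ∈ C_EA`** (iterated: `ln π > 0` since `π > 1`). -/
theorem log_log_pi_mem_logFreeCore_of_real_definable
    (hA : Summit.Schanuel.Schanuel.Theses.RigidCore.AclSubsetLogFreeCore)
    (hR : Set.Definable₁ (∅ : Set ℂ) Language.expRing (Set.range ((↑) : ℝ → ℂ))) :
    (Real.log (Real.log Real.pi) : ℂ) ∈ logFreeCore :=
  log_mem_logFreeCore_of_real_definable hA hR
    (Real.log_pos (by linarith [Real.pi_gt_three])) (log_pi_mem_logFreeCore_of_real_definable hA hR)

end Summit.Schanuel.Schanuel.Theorems.AclSubsetLogFreeCore.Negative
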